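import Literature.NumberTheory.Automorphic.ArchTorusWeylAction         -- ★ p838375 (F0P3a-p06): `monomial_conj_circleDiagonal`, `exists_conj_circleDiagonal_eq_of_sign`
import Literature.LinearAlgebra.Matrix.HermitianCongruenceInertia      -- ★ Sylvester: `card_pos_eq_of_conjTranspose_mul_diagonal_mul`
import HarnessLib

/-!
# Conjugacy classes of SINGULAR torus points of `U(diag e)(ℂ)` inside one stable class: the per-eigenvalue sign distribution
# (road D2′ gap «(V8)-sing»; Rogawski 1990 §3.1 p. 19, §8.3 p. 122 (§8.2 Prop. 8.2.1 p. 118) — the two classes through the split-singular point `diag(a,a,b)` of `U(2,1)`)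

Topic `NumberTheory/Automorphic`; namespace `Literature.NumberTheory.Automorphic.UnitaryGroup` (as ★ `ArchTorusWeylAction`, ★ `ArchDiagonalTorus`).
THEOREMS ONLY (no `def`, no instance, no notation, no axiom, no `sorry`).  Cell `pub/hodgecm-mathlib`, ENGINE T1 (crux H413 =
`stmt-HodgeConjecture-24833`); floor-1 preparation, count-neutral, under books rows #88 (ST-∞) ∕ #111 (S-d) (F0P3a-p02 (g8)'s
CENSUS-D2prime-HClimit §4 gap (V8) «class counts 3 ∕ 2 at ∞»); author B-p17 (g23) on LEAD WORD T7-5 (11) (F0P3a-plan (g8), 2026-09-01).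
DISJOINT from F0P3a-p02 (g9)'s «(V8)-reg» (`Injective z`): here `z` is ARBITRARY (fibres of any size); nothing below is stated for
injective `z` only.

SETTING. `e : Fin N → ℝ` a real diagonal form, `U = unitaryGroupOfForm (starRingEnd ℂ) (diagonal e) ≤ GL_N(ℂ)` (★ `UnitaryGroupAutomorphicRep`;
at a complex place `w` of a CM field this is ★ `archLocal L N (diagonal α) w` with `e = σ_w ∘ α`), torus points `diag z = circleDiagonal N z`
(★ D1′b), `z : Fin N → Circle`.  By ★ `charpoly_circleDiagonal_comp_perm` (p06) every relabelled point `diag (z ∘ ρ⁻¹)` is STABLY conjugate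
(= `GL_N(ℂ)`-conjugate, ★ `Rogawski1990.IsStablyConj`) to `diag z`; this file decides WHEN two such points are conjugate INSIDE `U`.

WHAT IS PROVED.
* §0 generic matrix lemmas (any `Fintype n`): (L0) a matrix commuting with `diag s` vanishes off the fibres of `s`;
  **(L1) PER-BLOCK SYLVESTER** `card_filter_fibre_pos_eq_of_conjTranspose_mul_diagonal_mul`: if `w` is invertible, block-diagonal along
  the fibres of a labelling `d : n → ι`, and `wᴴ · diag x · w = diag y` (`x, y` real), then over EVERY fibre `{d = a}` the numbers of positive
  entries of `x` and `y` agree (★ Sylvester `card_pos_eq_of_conjTranspose_mul_diagonal_mul` on the fibre block); (L2) two labellings with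
  fibres of the same sizes differ by a permutation (Mathlib `Equiv.ofFiberEquiv`).
* §1 **THE SIGN DISTRIBUTION IS A COMPLETE INVARIANT ON TORUS POINTS OF A STABLE CLASS** (any `z`): (A) if `g · diag z · g⁻¹ = diag (z ∘ ρ⁻¹)`
  with `g ∈ U` then for every eigenvalue `a` the fibre `{z = a}` carries as many positive `e (ρ j)` as positive `e j`
  (`card_filter_fibre_pos_eq_of_conj_circleDiagonal`); (B) conversely (`e_j ≠ 0`) equal per-fibre positive counts give a conjugator in `U`
  (`exists_conj_circleDiagonal_eq_of_card_filter_fibre_pos_eq`: a fibre-preserving sign-matching relabelling + ★ p06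
  `exists_conj_circleDiagonal_eq_of_sign`); (C) the `↔` and its reading on the relabelled point: the `U`-class of the torus point
  `diag (z ∘ ρ⁻¹)` in the stable class of `diag z` is determined by the numbers `p_a = #{i ∣ z (ρ⁻¹ i) = a ∧ 0 < e i}` of POSITIVE form
  entries over each eigenvalue fibre — the «sign distribution» `(p_a)_a` (for `Injective z` all fibres are singletons and this is the
  sign-PATTERN criterion of «(V8)-reg»; not restated).
* §2 DOCKING `N = 3`, `e` indefinite, `z` with EXACTLY TWO values (the split-singular torus point `γ₀ = diag(a,a,b)`, `a ≠ b`, of `U(2,1)`):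
  the six relabelled torus points of the stable class of `γ₀` fall into **EXACTLY TWO** `U`-classes («`b` over a negative slot» ∕ «`b` over a
  positive slot») — `card_image_conjClasses_circleDiagonal_perm_eq_two` — against THREE (`= choose 3 1`) through a regular point
  [Rogawski1990, §8.3 p. 122 (§8.2 Prop. 8.2.1 p. 118)].
NOT HERE (sequel «(V8)-exh»): that EVERY element of `U` stably conjugate to `diag z` is `U`-conjugate to some torus point `diag (z ∘ ρ⁻¹)`
(block spectral theorem along the fibres); with it §2 becomes a statement about the whole stable class.  HONEST LABEL: HC_CM is proved only
modulo the printed citations until rung 0 closes; this file is linear algebra and pays nothing by itself.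

## References
* [Rogawski1990] J. D. Rogawski, *Automorphic Representations of Unitary Groups in Three Variables*, Ann. of Math. Stud. 123 (1990): §3.1 p. 19
  (stable conjugacy in `U(n)` = conjugacy in `GL_n`), §3.8 pp. 30–32 (Prop. 3.8.1) (classes within a stable class), §8.3 p. 122 (§8.2 Prop. 8.2.1 p. 118) (the classes through regular
  and singular points of the compact Cartan of `U(2,1)`).
* [HornJohnson2013] R. A. Horn, C. R. Johnson, *Matrix Analysis*, 2nd ed. (2013), §4.5 Thm. 4.5.8 (Sylvester's law of inertia).
* [BrockerTomDieck1985] Th. Bröcker, T. tom Dieck, *Representations of Compact Lie Groups*, GTM 98 (1985), IV (3.2)–(3.3) (monomial matrices,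
  Weyl group of `U(n)`).
-/

set_option autoImplicit false

noncomputable section

open Matrix Equiv Finset
open Literature.LinearAlgebra.Matrix
open scoped MatrixGroups ComplexConjugate

namespace Literature.NumberTheory.Automorphic.UnitaryGroup

/-! ## §0 Generic matrix lemmas -/

section Generic

variable {n : Type*} [Fintype n] [DecidableEq n]

/-- **(L0)** A matrix commuting with a diagonal matrix vanishes off the fibres of the diagonal: `w · diag s = diag s · w` and `s i ≠ s j`
force `w i j = 0` (`w i j · s j = s i · w i j`). [cite: BrockerTomDieck1985, IV (3.2)] -/
theorem apply_eq_zero_of_mul_diagonal_comm {R : Type*} [CommRing R] [IsDomain R] {w : Matrix n n R} {s : n → R}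
    (h : w * diagonal s = diagonal s * w) {i j : n} (hij : s i ≠ s j) : w i j = 0 := by
  have h1 := congr_fun (congr_fun h i) j
  rw [mul_diagonal, diagonal_mul, mul_comm (s i)] at h1
  -- `w i j * s j = w i j * s i`
  by_contra hw
  exact hij (mul_left_cancel₀ hw h1).symm

omit [DecidableEq n] in
/-- Block of a product along a fibre of `d`, right factor block-diagonal: `(v · w)|_F = v|_F · w|_F` for `F = {d = a}` when `w` vanishes off
the fibres of `d`. [cite: HornJohnson2013, §0.7 (partitioned matrices)] -/
theorem submatrix_mul_of_fibre_right {R : Type*} [CommRing R] {ι : Type*} [DecidableEq ι] (d : n → ι) (a : ι) (v w : Matrix n n R)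
    (hw : ∀ i j, d i ≠ d j → w i j = 0) :
    (v * w).submatrix (Subtype.val : {j // d j = a} → n) (Subtype.val : {j // d j = a} → n) =
      v.submatrix (Subtype.val : {j // d j = a} → n) (Subtype.val : {j // d j = a} → n) * w.submatrix (Subtype.val : {j // d j = a} → n) (Subtype.val : {j // d j = a} → n) := by
  ext j j'
  simp only [submatrix_apply, mul_apply]
  rw [← Finset.sum_subtype (univ.filter fun k => d k = a) (fun k => by simp) (fun k => v j.1 k * w k j'.1)]
  refine (Finset.sum_subset (Finset.filter_subset _ _) fun k _ hk => ?_).symm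
  have hdk : d k ≠ d j'.1 := fun hkj => hk (Finset.mem_filter.mpr ⟨Finset.mem_univ _, hkj.trans j'.2⟩)
  rw [hw _ _ hdk, mul_zero]

omit [DecidableEq n] in
/-- Block of a product along a fibre of `d`, left factor block-diagonal: `(w · v)|_F = w|_F · v|_F`. [cite: HornJohnson2013, §0.7 (partitioned matrices)] -/
theorem submatrix_mul_of_fibre_left {R : Type*} [CommRing R] {ι : Type*} [DecidableEq ι] (d : n → ι) (a : ι) (w v : Matrix n n R)
    (hw : ∀ i j, d i ≠ d j → w i j = 0) :
    (w * v).submatrix (Subtype.val : {j // d j = a} → n) (Subtype.val : {j // d j = a} → n) =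
      w.submatrix (Subtype.val : {j // d j = a} → n) (Subtype.val : {j // d j = a} → n) * v.submatrix (Subtype.val : {j // d j = a} → n) (Subtype.val : {j // d j = a} → n) := by
  ext j j'
  simp only [submatrix_apply, mul_apply]
  rw [← Finset.sum_subtype (univ.filter fun k => d k = a) (fun k => by simp) (fun k => w j.1 k * v k j'.1)]
  refine (Finset.sum_subset (Finset.filter_subset _ _) fun k _ hk => ?_).symm
  have hdk : d j.1 ≠ d k := fun hjk => hk (Finset.mem_filter.mpr ⟨Finset.mem_univ _, hjk.symm.trans j.2⟩)
  rw [hw _ _ hdk, zero_mul]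

omit [Fintype n] [DecidableEq n] in
/-- The conjugate transpose of a block-diagonal matrix is block-diagonal along the same fibres. [cite: HornJohnson2013, §0.7 (partitioned matrices)] -/
theorem conjTranspose_apply_eq_zero_of_fibre {R : Type*} [CommRing R] [StarRing R] {ι : Type*} (d : n → ι) (w : Matrix n n R)
    (hw : ∀ i j, d i ≠ d j → w i j = 0) (i j : n) (hij : d i ≠ d j) : wᴴ i j = 0 := by
  rw [conjTranspose_apply, hw _ _ (Ne.symm hij), star_zero]

omit [DecidableEq n] in
/-- Number of fibre elements satisfying a predicate, read on the fibre subtype. [folklore] -/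
private theorem card_filter_subtype_fibre_eq {ι : Type*} [DecidableEq ι] (d : n → ι) (a : ι) (p : n → Prop) [DecidablePred p] :
    (univ.filter fun j : {j // d j = a} => p j.1).card = (univ.filter fun j => d j = a ∧ p j).card := by
  rw [← Fintype.card_subtype, ← Fintype.card_subtype]
  exact Fintype.card_congr (Equiv.subtypeSubtypeEquivSubtypeInter (fun j => d j = a) p)

/-- **(L1) PER-BLOCK SYLVESTER.**  Let `w` be invertible and block-diagonal along the fibres of a labelling `d : n → ι` (`w i j = 0` whenever
`d i ≠ d j`), and `wᴴ · diag x · w = diag y` with `x, y` real.  Then over every fibre `{j ∣ d j = a}` the diagonal forms `diag x` and `diag y` have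
the same number of POSITIVE entries: the fibre block of `w` is invertible (its inverse is the fibre block of `w⁻¹`) and realises a `ᴴ`-congruence
of the two restricted diagonal forms, so Sylvester's law of inertia (★ `card_pos_eq_of_conjTranspose_mul_diagonal_mul`) applies block by block.
[cite: HornJohnson2013, §4.5 Thm 4.5.8 (Sylvester)] -/
theorem card_filter_fibre_pos_eq_of_conjTranspose_mul_diagonal_mul {ι : Type*} [DecidableEq ι] (d : n → ι) (w : Matrix n n ℂ)
    [Invertible w] (hw : ∀ i j, d i ≠ d j → w i j = 0) (x y : n → ℝ)
    (h : wᴴ * diagonal (fun i => (x i : ℂ)) * w = diagonal (fun i => (y i : ℂ))) (a : ι) :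
    (univ.filter fun j => d j = a ∧ 0 < x j).card = (univ.filter fun j => d j = a ∧ 0 < y j).card := by
  -- fibre blocks of `w` and `⅟w`
  set P : Matrix {j // d j = a} {j // d j = a} ℂ := w.submatrix (Subtype.val : {j // d j = a} → n) (Subtype.val : {j // d j = a} → n) with hP
  set Q : Matrix {j // d j = a} {j // d j = a} ℂ := (⅟ w).submatrix (Subtype.val : {j // d j = a} → n) (Subtype.val : {j // d j = a} → n) with hQ
  have h1 : (1 : Matrix n n ℂ).submatrix (Subtype.val : {j // d j = a} → n) (Subtype.val : {j // d j = a} → n) = 1 := by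
    ext j j'
    simp only [submatrix_apply, one_apply, Subtype.ext_iff]
  have hQP : Q * P = 1 := by
    rw [hQ, hP, ← submatrix_mul_of_fibre_right d a (⅟ w) w hw, invOf_mul_self, h1]
  haveI : Invertible P := invertibleOfLeftInverse P Q hQP
  -- the restricted congruence `Pᴴ · diag (x|_F) · P = diag (y|_F)`
  have hcong : Pᴴ * diagonal (fun j : {j // d j = a} => (x j.1 : ℂ)) * P = diagonal (fun j => (y j.1 : ℂ)) := by
    have hv : (wᴴ * diagonal (fun i => (x i : ℂ))).submatrix (Subtype.val : {j // d j = a} → n) Subtype.val =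
        Pᴴ * diagonal (fun j : {j // d j = a} => (x j.1 : ℂ)) := by
      ext j j'
      simp only [hP, submatrix_apply, mul_diagonal, conjTranspose_apply]
    have := congr_arg (fun M : Matrix n n ℂ => M.submatrix (Subtype.val : {j // d j = a} → n) (Subtype.val : {j // d j = a} → n)) h
    rw [submatrix_mul_of_fibre_right d a _ w hw, hv] at this
    rw [this]
    ext j j'
    simp only [submatrix_apply, diagonal_apply, Subtype.ext_iff]
  have hS := card_pos_eq_of_conjTranspose_mul_diagonal_mul (fun j : {j // d j = a} => x j.1) (fun j => y j.1) P hcong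
  rw [card_filter_subtype_fibre_eq d a (fun j => 0 < x j), card_filter_subtype_fibre_eq d a (fun j => 0 < y j)] at hS
  exact hS

omit [DecidableEq n] in
/-- **(L2)** Two labellings of a finite set with fibres of equal sizes differ by a permutation: `g ∘ π = f` (Mathlib `Equiv.ofFiberEquiv`).
[folklore] -/
private theorem exists_perm_forall_apply_eq {ι : Type*} [DecidableEq ι] (f g : n → ι)
    (h : ∀ a, (univ.filter fun j => f j = a).card = (univ.filter fun j => g j = a).card) :
    ∃ π : Equiv.Perm n, ∀ j, g (π j) = f j := by
  have hc : ∀ a, Fintype.card {j // f j = a} = Fintype.card {j // g j = a} := fun a => by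
    rw [Fintype.card_subtype, Fintype.card_subtype, h a]
  exact ⟨Equiv.ofFiberEquiv (f := f) (g := g) fun a => Fintype.equivOfCardEq (hc a), fun j => Equiv.ofFiberEquiv_map _ j⟩

end Generic

/-! ## §1 Torus points of one stable class: the per-fibre sign distribution is a complete invariant -/

section Torus

variable (N : ℕ)

open scoped Classical in
/-- **(A) NECESSITY OF THE SIGN DISTRIBUTION.**  If `g ∈ U(diag e)(ℂ)` conjugates the torus point `diag z` to the relabelled point
`diag (z ∘ ρ⁻¹)`, then over every eigenvalue fibre `{j ∣ z j = a}` there are as many positive `e (ρ j)` as positive `e j` — i.e. the relabelled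
point carries, over each eigenvalue, the same number of POSITIVE form entries as `diag z`.  (`w := M(ρ,1)⁻¹ g` commutes with `diag z`
(★ `monomial_conj_circleDiagonal`), hence is block-diagonal along the fibres, and `wᴴ · diag (e ∘ ρ) · w = diag e`
(★ `conjTranspose_mul_diagonal_mul_monomial`); then per-block Sylvester (L1).)  No hypothesis on `e`; `z` arbitrary.
[cite: Rogawski1990, §3.1 p. 19; §8.3 p. 122 (§8.2 Prop. 8.2.1 p. 118)] [cite: HornJohnson2013, §4.5 Thm 4.5.8 (Sylvester)] -/
theorem card_filter_fibre_pos_eq_of_conj_circleDiagonal {e : Fin N → ℝ} {z : Fin N → Circle} {ρ : Perm (Fin N)}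
    (g : unitaryGroupOfForm (starRingEnd ℂ) (Matrix.diagonal fun j => (e j : ℂ)))
    (h : (g : GL (Fin N) ℂ) * circleDiagonal N z * (g : GL (Fin N) ℂ)⁻¹ = circleDiagonal N (fun i => z (ρ.symm i)))
    (a : Circle) :
    (univ.filter fun j => z j = a ∧ 0 < e (ρ j)).card = (univ.filter fun j => z j = a ∧ 0 < e j).card := by
  -- the permutation matrix `M = M(ρ, 1)` and `w := M⁻¹ g`
  set M : GL (Fin N) ℂ := Matrix.GeneralLinearGroup.mkOfDetNeZero _ (det_monomial_one_ne_zero N ρ) with hM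
  have hMz : M * circleDiagonal N z * M⁻¹ = circleDiagonal N (fun i => z (ρ.symm i)) := monomial_conj_circleDiagonal N ρ z
  set w : GL (Fin N) ℂ := M⁻¹ * (g : GL (Fin N) ℂ) with hw
  -- `w` commutes with `diag z`
  have hg' : (g : GL (Fin N) ℂ) * circleDiagonal N z = circleDiagonal N (fun i => z (ρ.symm i)) * (g : GL (Fin N) ℂ) :=
    mul_inv_eq_iff_eq_mul.mp h
  have hM' : M⁻¹ * circleDiagonal N (fun i => z (ρ.symm i)) = circleDiagonal N z * M⁻¹ := by
    rw [← hMz]; simp only [mul_assoc, inv_mul_cancel_left]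
  have hcomm : w * circleDiagonal N z = circleDiagonal N z * w := by
    calc w * circleDiagonal N z = M⁻¹ * ((g : GL (Fin N) ℂ) * circleDiagonal N z) := by rw [hw, mul_assoc]
      _ = M⁻¹ * circleDiagonal N (fun i => z (ρ.symm i)) * (g : GL (Fin N) ℂ) := by rw [hg', mul_assoc]
      _ = circleDiagonal N z * w := by rw [hM', hw, mul_assoc]
  have hcommM : (w : Matrix (Fin N) (Fin N) ℂ) * diagonal (fun i => (z i : ℂ)) = diagonal (fun i => (z i : ℂ)) * (w : Matrix (Fin N) (Fin N) ℂ) := by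
    have := congrArg (fun u : GL (Fin N) ℂ => (u : Matrix (Fin N) (Fin N) ℂ)) hcomm
    simpa only [Units.val_mul, coe_circleDiagonal] using this
  -- hence block-diagonal along the fibres of `z`
  have hwz : ∀ i j, z i ≠ z j → (w : Matrix (Fin N) (Fin N) ℂ) i j = 0 := fun i j hij =>
    apply_eq_zero_of_mul_diagonal_comm hcommM fun hc => hij (Circle.ext hc)
  -- the form: `wᴴ · diag (e ∘ ρ) · w = diag e`
  have hgw : ((g : GL (Fin N) ℂ) : Matrix (Fin N) (Fin N) ℂ) = (M : Matrix (Fin N) (Fin N) ℂ) * (w : Matrix (Fin N) (Fin N) ℂ) := by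
    rw [hw, ← Units.val_mul, mul_inv_cancel_left]
  have hU : (((g : GL (Fin N) ℂ) : Matrix (Fin N) (Fin N) ℂ).map (starRingEnd ℂ))ᵀ * diagonal (fun j => (e j : ℂ)) *
      ((g : GL (Fin N) ℂ) : Matrix (Fin N) (Fin N) ℂ) = diagonal (fun j => (e j : ℂ)) := mem_unitaryGroupOfForm_iff.mp g.2
  have hct : (((g : GL (Fin N) ℂ) : Matrix (Fin N) (Fin N) ℂ).map (starRingEnd ℂ))ᵀ = ((g : GL (Fin N) ℂ) : Matrix (Fin N) (Fin N) ℂ)ᴴ := rfl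
  have hMD : (M : Matrix (Fin N) (Fin N) ℂ)ᴴ * diagonal (fun j => (e j : ℂ)) * (M : Matrix (Fin N) (Fin N) ℂ) =
      diagonal (fun j => (e (ρ j) : ℂ)) := by
    rw [hM, Matrix.GeneralLinearGroup.val_mkOfDetNeZero]
    exact conjTranspose_mul_diagonal_mul_monomial (fun _ => by simp) _
  have hform : (w : Matrix (Fin N) (Fin N) ℂ)ᴴ * diagonal (fun j => ((e (ρ j) : ℝ) : ℂ)) * (w : Matrix (Fin N) (Fin N) ℂ) =
      diagonal (fun j => (e j : ℂ)) := by
    rw [hct, hgw, conjTranspose_mul] at hU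
    calc (w : Matrix (Fin N) (Fin N) ℂ)ᴴ * diagonal (fun j => ((e (ρ j) : ℝ) : ℂ)) * (w : Matrix (Fin N) (Fin N) ℂ)
        = (w : Matrix (Fin N) (Fin N) ℂ)ᴴ * ((M : Matrix (Fin N) (Fin N) ℂ)ᴴ * diagonal (fun j => (e j : ℂ)) * (M : Matrix (Fin N) (Fin N) ℂ)) *
            (w : Matrix (Fin N) (Fin N) ℂ) := by rw [hMD]
      _ = (w : Matrix (Fin N) (Fin N) ℂ)ᴴ * (M : Matrix (Fin N) (Fin N) ℂ)ᴴ * diagonal (fun j => (e j : ℂ)) *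
            ((M : Matrix (Fin N) (Fin N) ℂ) * (w : Matrix (Fin N) (Fin N) ℂ)) := by simp only [Matrix.mul_assoc]
      _ = diagonal (fun j => (e j : ℂ)) := hU
  haveI : Invertible ((w : GL (Fin N) ℂ) : Matrix (Fin N) (Fin N) ℂ) := w.invertible
  exact card_filter_fibre_pos_eq_of_conjTranspose_mul_diagonal_mul z (w : Matrix (Fin N) (Fin N) ℂ) hwz (fun j => e (ρ j)) e hform a

open scoped Classical in
/-- Counting over a fibre and its complement inside the fibre: equal positive counts give equal non-positive counts. [folklore] -/
private theorem card_filter_fibre_not_eq_of_card_filter_fibre_eq {ι : Type*} (d : Fin N → ι) (a : ι)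
    (p q : Fin N → Prop)
    (h : (univ.filter fun j => d j = a ∧ p j).card = (univ.filter fun j => d j = a ∧ q j).card) :
    (univ.filter fun j => d j = a ∧ ¬ p j).card = (univ.filter fun j => d j = a ∧ ¬ q j).card := by
  have hp := Finset.card_filter_add_card_filter_not (s := univ.filter fun j => d j = a) p
  have hq := Finset.card_filter_add_card_filter_not (s := univ.filter fun j => d j = a) q
  simp only [Finset.filter_filter] at hp hq
  omega

open scoped Classical in
/-- **(B) SUFFICIENCY OF THE SIGN DISTRIBUTION** (`e_j ≠ 0`).  If over every eigenvalue fibre `{j ∣ z j = a}` the relabelling `ρ` keeps the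
number of positive form entries (`#{j ∣ z j = a ∧ 0 < e (ρ j)} = #{j ∣ z j = a ∧ 0 < e j}`), then `diag z` and `diag (z ∘ ρ⁻¹)` are conjugate
INSIDE `U(diag e)(ℂ)`: a fibre-preserving, sign-matching relabelling `π` exists (L2), `σ := ρ π⁻¹` is sign-pattern preserving, and ★
`exists_conj_circleDiagonal_eq_of_sign` (F0P3a-p06) conjugates `diag z` to `diag (z ∘ σ⁻¹) = diag (z ∘ ρ⁻¹)`.
[cite: Rogawski1990, §8.3 p. 122 (§8.2 Prop. 8.2.1 p. 118); §3.1 p. 19] [cite: BrockerTomDieck1985, IV (3.2)] -/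
theorem exists_conj_circleDiagonal_eq_of_card_filter_fibre_pos_eq {e : Fin N → ℝ} (he : ∀ j, e j ≠ 0) {z : Fin N → Circle}
    {ρ : Perm (Fin N)}
    (h : ∀ a : Circle, (univ.filter fun j => z j = a ∧ 0 < e (ρ j)).card = (univ.filter fun j => z j = a ∧ 0 < e j).card) :
    ∃ g : unitaryGroupOfForm (starRingEnd ℂ) (Matrix.diagonal fun j => (e j : ℂ)),
      (g : GL (Fin N) ℂ) * circleDiagonal N z * (g : GL (Fin N) ℂ)⁻¹ = circleDiagonal N (fun i => z (ρ.symm i)) := by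
  -- a fibre-preserving relabelling `π` matching the signs of `e ∘ ρ`
  have hfib : ∀ c : Circle × Bool, (univ.filter fun j => (z j, decide (0 < e (ρ j))) = c).card =
      (univ.filter fun j => (z j, decide (0 < e j)) = c).card := by
    rintro ⟨a, b⟩
    cases b
    · have h' := card_filter_fibre_not_eq_of_card_filter_fibre_eq N z a (fun j => 0 < e (ρ j)) (fun j => 0 < e j) (h a)
      convert h' using 2 <;> · ext j; simp
    · convert h a using 2 <;> · ext j; simp
  obtain ⟨π, hπ⟩ := exists_perm_forall_apply_eq (fun j => (z j, decide (0 < e (ρ j)))) (fun j => (z j, decide (0 < e j))) hfib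
  have hzπ : ∀ j, z (π j) = z j := fun j => (Prod.ext_iff.mp (hπ j)).1
  have hsπ : ∀ j, (0 < e (π j) ↔ 0 < e (ρ j)) := fun j => by
    have h2 := (Prod.ext_iff.mp (hπ j)).2
    simpa using h2
  -- `σ := ρ π⁻¹` is sign-matched
  have hpos : ∀ j, 0 < e j / e ((ρ * π⁻¹) j) := by
    intro j
    have hj := hsπ (π⁻¹ j)
    rw [Perm.inv_def, Equiv.apply_symm_apply] at hj
    rw [Perm.mul_apply]
    rcases lt_or_gt_of_ne (he j) with hneg | hposj
    · have hneg' : e (ρ (π⁻¹ j)) < 0 := lt_of_le_of_ne (not_lt.mp fun hh => (lt_irrefl _ (hneg.trans (hj.mpr hh))).elim) (he _)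
      exact div_pos_of_neg_of_neg hneg hneg'
    · exact div_pos hposj (hj.mp hposj)
  obtain ⟨g, hg⟩ := exists_conj_circleDiagonal_eq_of_sign N hpos z
  refine ⟨g, hg.trans ?_⟩
  congr 1
  funext i
  -- `(ρ π⁻¹)⁻¹ i = π (ρ⁻¹ i)` and `z ∘ π = z`
  have : (ρ * π⁻¹).symm i = π (ρ.symm i) := by
    rw [← Perm.inv_def, _root_.mul_inv_rev, inv_inv, Perm.mul_apply, Perm.inv_def]
  rw [this, hzπ]

open scoped Classical in
/-- **(C) THE SIGN DISTRIBUTION IS A COMPLETE INVARIANT** (`e_j ≠ 0`, `z` arbitrary): `diag z` and the relabelled torus point `diag (z ∘ ρ⁻¹)` of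
its stable class are conjugate in `U(diag e)(ℂ)` iff over every eigenvalue fibre the relabelling keeps the number of positive form entries.
[cite: Rogawski1990, §3.1 p. 19; §8.3 p. 122 (§8.2 Prop. 8.2.1 p. 118)] [cite: HornJohnson2013, §4.5 Thm 4.5.8 (Sylvester)] -/
theorem exists_conj_circleDiagonal_eq_iff_card_filter_fibre_pos_eq {e : Fin N → ℝ} (he : ∀ j, e j ≠ 0) (z : Fin N → Circle)
    (ρ : Perm (Fin N)) :
    (∃ g : unitaryGroupOfForm (starRingEnd ℂ) (Matrix.diagonal fun j => (e j : ℂ)),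
        (g : GL (Fin N) ℂ) * circleDiagonal N z * (g : GL (Fin N) ℂ)⁻¹ = circleDiagonal N (fun i => z (ρ.symm i))) ↔
      ∀ a : Circle, (univ.filter fun j => z j = a ∧ 0 < e (ρ j)).card = (univ.filter fun j => z j = a ∧ 0 < e j).card :=
  ⟨fun ⟨g, hg⟩ a => card_filter_fibre_pos_eq_of_conj_circleDiagonal N g hg a,
    exists_conj_circleDiagonal_eq_of_card_filter_fibre_pos_eq N he⟩

open scoped Classical in
/-- Reindexing the invariant onto the relabelled point: `#{j ∣ z j = a ∧ 0 < e (ρ j)} = #{i ∣ z (ρ⁻¹ i) = a ∧ 0 < e i}` — the number of POSITIVE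
form entries over the eigenvalue fibre `a` of the torus point `diag (z ∘ ρ⁻¹)` (its «sign distribution» `p_a`). [folklore] -/
private theorem card_filter_fibre_pos_perm_eq (e : Fin N → ℝ) (z : Fin N → Circle) (ρ : Perm (Fin N)) (a : Circle) :
    (univ.filter fun j => z j = a ∧ 0 < e (ρ j)).card = (univ.filter fun i => z (ρ.symm i) = a ∧ 0 < e i).card := by
  rw [← Fintype.card_subtype, ← Fintype.card_subtype]
  exact Fintype.card_congr (Equiv.subtypeEquiv ρ fun j => by simp only [Equiv.symm_apply_apply])

open scoped Classical in
/-- **(C′) READING ON THE RELABELLED POINT**: `diag (z ∘ ρ⁻¹)` is `U(diag e)(ℂ)`-conjugate to `diag z` iff over EVERY eigenvalue `a` the two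
torus points carry the same number of positive form entries, `#{i ∣ z (ρ⁻¹ i) = a ∧ 0 < e i} = #{i ∣ z i = a ∧ 0 < e i}` — the classes of torus
points inside one stable class are labelled by the sign distributions `(p_a)_a` (with `p_a ≤ m_a` the multiplicity and `Σ_a p_a = #{0 < e}`).
For injective `z` every fibre is a singleton and this is the sign-PATTERN criterion. [cite: Rogawski1990, §3.8 pp. 30–32 (Prop. 3.8.1); §8.3 p. 122 (§8.2 Prop. 8.2.1 p. 118)] -/
theorem exists_conj_circleDiagonal_eq_iff_signDistribution_eq {e : Fin N → ℝ} (he : ∀ j, e j ≠ 0) (z : Fin N → Circle)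
    (ρ : Perm (Fin N)) :
    (∃ g : unitaryGroupOfForm (starRingEnd ℂ) (Matrix.diagonal fun j => (e j : ℂ)),
        (g : GL (Fin N) ℂ) * circleDiagonal N z * (g : GL (Fin N) ℂ)⁻¹ = circleDiagonal N (fun i => z (ρ.symm i))) ↔
      ∀ a : Circle, (univ.filter fun i => z (ρ.symm i) = a ∧ 0 < e i).card = (univ.filter fun i => z i = a ∧ 0 < e i).card := by
  rw [exists_conj_circleDiagonal_eq_iff_card_filter_fibre_pos_eq N he z ρ]
  refine forall_congr' fun a => ?_
  rw [card_filter_fibre_pos_perm_eq N e z ρ a]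

/-- **(C″) BRIDGE TO CONJUGACY CLASSES OF THE SUBGROUP**: for elements `x, y` of a subgroup `H ≤ G`, `ConjClasses.mk x = ConjClasses.mk y` iff
some `g ∈ H` conjugates `x` to `y` in `G`. [folklore] -/
private theorem conjClasses_mk_eq_mk_iff_exists_coe_conj {G : Type*} [Group G] {H : Subgroup G} (x y : H) :
    ConjClasses.mk x = ConjClasses.mk y ↔ ∃ g : H, (g : G) * (x : G) * (g : G)⁻¹ = y := by
  rw [ConjClasses.mk_eq_mk_iff_isConj, isConj_iff]
  constructor
  · rintro ⟨c, hc⟩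
    exact ⟨c, by rw [← hc, Subgroup.coe_mul, Subgroup.coe_mul, Subgroup.coe_inv]⟩
  · rintro ⟨g, hg⟩
    exact ⟨g, Subtype.ext (by rw [Subgroup.coe_mul, Subgroup.coe_mul, Subgroup.coe_inv]; exact hg)⟩

open scoped Classical in
/-- **(C‴) ON CLASSES**: the torus points `diag z`, `diag (z ∘ ρ⁻¹)` (both in `U(diag e)(ℂ)` by ★ `circleDiagonal_mem_unitaryGroupOfForm_diagonal`)
define the SAME conjugacy class of `U(diag e)(ℂ)` iff their sign distributions agree. [cite: Rogawski1990, §3.8 pp. 30–32 (Prop. 3.8.1); §8.3 p. 122 (§8.2 Prop. 8.2.1 p. 118)] -/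
theorem conjClasses_mk_circleDiagonal_eq_iff_signDistribution_eq {e : Fin N → ℝ} (he : ∀ j, e j ≠ 0) (z : Fin N → Circle)
    (ρ : Perm (Fin N)) :
    ConjClasses.mk (⟨circleDiagonal N z, circleDiagonal_mem_unitaryGroupOfForm_diagonal N z _⟩ :
        unitaryGroupOfForm (starRingEnd ℂ) (Matrix.diagonal fun j => (e j : ℂ))) =
      ConjClasses.mk ⟨circleDiagonal N (fun i => z (ρ.symm i)), circleDiagonal_mem_unitaryGroupOfForm_diagonal N _ _⟩ ↔
      ∀ a : Circle, (univ.filter fun i => z (ρ.symm i) = a ∧ 0 < e i).card = (univ.filter fun i => z i = a ∧ 0 < e i).card := by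
  rw [conjClasses_mk_eq_mk_iff_exists_coe_conj, ← exists_conj_circleDiagonal_eq_iff_signDistribution_eq N he z ρ]

end Torus

end Literature.NumberTheory.Automorphic.UnitaryGroup
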